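import Summits.FinalStateConjecture.FinalStateConjecture.Theorems.PhotonSphereChannelsTameCensorshipExactRegionCausality
import Literature.Geometry.Lorentzian.LorentzianDistance
import Literature.Geometry.Lorentzian.DataEmbeddingOneJetPointwise
import HarnessLib

/-!
# Crux `TameCensorship` (stmt-FinalStateConjecture-10047), line `crush-the-swallowed-interior`:
# clause (B3) of stub B (`stub_exactKerrBookkeeping`) — the time separation of the exact region
# is dominated through the exact chart

Clause (B3) of the registered stub `stub_exactKerrBookkeeping` bounds the time separation
`d_𝒟(p, q)` of two points of the exact region `E = J⁺(ιX) ∖ J⁺(ιK)` when `χ p` lies in the Kerr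
black hole. This file proves the def-free REDUCTION of that clause to a bound in the target: if
`χ` is smooth on an open `E' ⊇ E` with `χ^* g_𝓣 = g_𝒟` and `dχ` time-orientation preserving on
`E'` (the output of `exactRegion_of_leafMaximal_oriented`), then

* `isFutureCausalCurveOn_comp_of_exactRegion` — `χ` carries every future causal curve segment of
  `𝒟` between two points of `E` to a future causal curve segment of `𝓣` (the segment stays in
  `E`, `curve_mem_exactRegion`; chain rule; pointwise timecone lemma
  `TimeOrientation.isFutureDirected_mfderiv_at`),
* `arcLength_comp_of_exactRegion` — of the same length (`χ^* g_𝓣 = g_𝒟` along the segment),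
* `lorentzDist_le_lorentzDist_comp_of_exactRegion` — hence `d_𝒟(p, q) ≤ d_𝓣(χ p, χ q)` for
  `p, q ∈ E` (O'Neill 1983, Ch. 14, Def. 14.15: the time separation is the supremum of those
  lengths),
* `lorentzDist_le_of_exactRegion` — so a uniform bound `d_𝓣(χ p, ·) ≤ C` in the target (for Kerr:
  the finite timelike diameter of region II above a point with `r < r₊`, a named fact about the
  explicit metric) gives `d_𝒟(p, q) ≤ C` for all `q ∈ E` — the shape of clause (B3).

References: O'Neill 1983, Ch. 5, Def. 5.11, p. 145; Ch. 14, Def. 14.15 (p. 409), pp. 402–403;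
Beem–Ehrlich–Easley 1996, Ch. 4 (Lorentzian distance under isometries).
-/

noncomputable section

-- The tree namespace `Summit.FinalStateConjecture.FinalStateConjecture.…` (summit = sub-problem)
-- repeats a component by design (D-0022), which the `dupNamespace` linter would flag on every decl.
set_option linter.dupNamespace false

open scoped Manifold ContDiff Topology ENNReal
open Set Filter Function TopologicalSpace Topology MeasureTheory
open Literature.Geometry.Lorentzian

namespace Summit.FinalStateConjecture.FinalStateConjecture.Theorems.PhotonSphereChannels.TameCensorshipCrush

universe u

variable {n : ℕ} {X : Type u} [TopologicalSpace X] [ChartedSpace (EuclideanSpace ℝ (Fin n)) X]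
  [IsManifold (𝓡 n) ∞ X] [ConnectedSpace X] {D : InitialDataSet (𝓡 n) X}

/-- **The exact chart carries future causal segments between points of the exact region to future
causal segments.** A future causal curve `γ` on `[a, b]` from `γ a ∈ E` to `γ b ∈ E`,
`E = J⁺(S) ∖ J⁺(T)`, stays in `E ⊆ E'` (`curve_mem_exactRegion`), where `χ` is differentiable,
isometric and time-orientation preserving; so `χ ∘ γ` is a future causal curve of the target
(velocity `dχ(γ')`, future-directed by the timecone lemma). O'Neill 1983, Ch. 14, p. 402.
[cite: ONeillSemiRiemannian1983, Ch. 14, p. 402; Ch. 5, p. 145] -/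
theorem isFutureCausalCurveOn_comp_of_exactRegion (𝒟 : CauchyDevelopment D) (S T : Set 𝒟.carrier)
    (𝓣 : Spacetime.{u} (n + 1)) {E' : Set 𝒟.carrier} {χ : 𝒟.carrier → 𝓣.carrier}
    (hEE' : 𝒟.metric.causalFuture 𝒟.timeOrientation S \ 𝒟.metric.causalFuture 𝒟.timeOrientation T ⊆ E')
    (hE'o : IsOpen E') (hχs : ContMDiffOn (𝓡 (n + 1)) (𝓡 (n + 1)) ∞ χ E')
    (hχi : ∀ p ∈ E', pullbackBilin (I := 𝓡 (n + 1)) (I' := 𝓡 (n + 1)) χ 𝓣.metric.val p =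
      𝒟.metric.val p)
    (hχτ : ∀ p ∈ E', 𝓣.timeOrientation.IsFutureDirected
      (mfderiv (𝓡 (n + 1)) (𝓡 (n + 1)) χ p (𝒟.timeOrientation.vectorField p)))
    {γ : ℝ → 𝒟.carrier} {a b : ℝ}
    (hγ : 𝒟.metric.IsFutureCausalCurveOn 𝒟.timeOrientation γ (Icc a b))
    (ha : γ a ∈ 𝒟.metric.causalFuture 𝒟.timeOrientation S \ 𝒟.metric.causalFuture 𝒟.timeOrientation T)
    (hb : γ b ∈ 𝒟.metric.causalFuture 𝒟.timeOrientation S \ 𝒟.metric.causalFuture 𝒟.timeOrientation T) :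
    𝓣.metric.IsFutureCausalCurveOn 𝓣.timeOrientation (χ ∘ γ) (Icc a b) := by
  intro t ht
  have hγE : γ t ∈ E' := hEE' (curve_mem_exactRegion 𝒟 S T hγ ha hb ht)
  obtain ⟨hd, hfd⟩ := hγ t ht
  have hχd : MDifferentiableAt (𝓡 (n + 1)) (𝓡 (n + 1)) χ (γ t) :=
    ((hχs (γ t) hγE).contMDiffAt (hE'o.mem_nhds hγE)).mdifferentiableAt (by simp)
  refine ⟨hχd.comp t hd, ?_⟩
  have hvel : velocity (𝓡 (n + 1)) (χ ∘ γ) t =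
      mfderiv (𝓡 (n + 1)) (𝓡 (n + 1)) χ (γ t) (velocity (𝓡 (n + 1)) γ t) := by
    unfold velocity
    rw [mfderiv_comp t hχd hd]
    rfl
  rw [hvel]
  exact TimeOrientation.isFutureDirected_mfderiv_at (hχτ _ hγE) (hχi _ hγE) hfd

/-- **The exact chart preserves the length of causal segments between points of the exact
region**: along such a segment `χ^* g_𝓣 = g_𝒟`, so the speeds `|g(γ', γ')|^{1/2}` of `γ` and of
`χ ∘ γ` agree at every parameter of `[a, b]`. O'Neill 1983, Ch. 5, Def. 5.11.
[cite: ONeillSemiRiemannian1983, Ch. 5, Def. 5.11 (pp. 131–132)] -/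
theorem arcLength_comp_of_exactRegion (𝒟 : CauchyDevelopment D) (S T : Set 𝒟.carrier)
    (𝓣 : Spacetime.{u} (n + 1)) {E' : Set 𝒟.carrier} {χ : 𝒟.carrier → 𝓣.carrier}
    (hEE' : 𝒟.metric.causalFuture 𝒟.timeOrientation S \ 𝒟.metric.causalFuture 𝒟.timeOrientation T ⊆ E')
    (hE'o : IsOpen E') (hχs : ContMDiffOn (𝓡 (n + 1)) (𝓡 (n + 1)) ∞ χ E')
    (hχi : ∀ p ∈ E', pullbackBilin (I := 𝓡 (n + 1)) (I' := 𝓡 (n + 1)) χ 𝓣.metric.val p =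
      𝒟.metric.val p)
    {γ : ℝ → 𝒟.carrier} {a b : ℝ}
    (hγ : 𝒟.metric.IsFutureCausalCurveOn 𝒟.timeOrientation γ (Icc a b))
    (ha : γ a ∈ 𝒟.metric.causalFuture 𝒟.timeOrientation S \ 𝒟.metric.causalFuture 𝒟.timeOrientation T)
    (hb : γ b ∈ 𝒟.metric.causalFuture 𝒟.timeOrientation S \ 𝒟.metric.causalFuture 𝒟.timeOrientation T) :
    𝓣.metric.toPseudoRiemannianMetric.arcLength (χ ∘ γ) a b =
      𝒟.metric.toPseudoRiemannianMetric.arcLength γ a b := by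
  rw [PseudoRiemannianMetric.arcLength_eq_lintegral_Icc,
    PseudoRiemannianMetric.arcLength_eq_lintegral_Icc]
  refine setLIntegral_congr_fun measurableSet_Icc fun t ht ↦ ?_
  have hγE : γ t ∈ E' := hEE' (curve_mem_exactRegion 𝒟 S T hγ ha hb ht)
  obtain ⟨hd, -⟩ := hγ t ht
  have hχd : MDifferentiableAt (𝓡 (n + 1)) (𝓡 (n + 1)) χ (γ t) :=
    ((hχs (γ t) hγE).contMDiffAt (hE'o.mem_nhds hγE)).mdifferentiableAt (by simp)
  have hvel : velocity (𝓡 (n + 1)) (χ ∘ γ) t =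
      mfderiv (𝓡 (n + 1)) (𝓡 (n + 1)) χ (γ t) (velocity (𝓡 (n + 1)) γ t) := by
    unfold velocity
    rw [mfderiv_comp t hχd hd]
    rfl
  have key : 𝓣.metric.val ((χ ∘ γ) t) (velocity (𝓡 (n + 1)) (χ ∘ γ) t)
      (velocity (𝓡 (n + 1)) (χ ∘ γ) t) =
      𝒟.metric.val (γ t) (velocity (𝓡 (n + 1)) γ t) (velocity (𝓡 (n + 1)) γ t) := by
    have h := congrArg (fun B ↦ B (velocity (𝓡 (n + 1)) γ t) (velocity (𝓡 (n + 1)) γ t))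
      (hχi _ hγE)
    simp only [pullbackBilin_apply] at h
    rw [hvel]
    exact h
  rw [PseudoRiemannianMetric.speed_def, PseudoRiemannianMetric.speed_def, key]

/-- **The time separation of the exact region is dominated through the exact chart**:
`d_𝒟(p, q) ≤ d_𝓣(χ p, χ q)` for `p, q ∈ E = J⁺(S) ∖ J⁺(T)` — every competing segment of `𝒟`
from `p` to `q` is carried by `χ` to a competing segment of `𝓣` from `χ p` to `χ q` of the same
length (O'Neill 1983, Ch. 14, Def. 14.15: `d` is the supremum of those lengths).
[cite: ONeillSemiRiemannian1983, Ch. 14, Def. 14.15 (p. 409)] -/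
theorem lorentzDist_le_lorentzDist_comp_of_exactRegion (𝒟 : CauchyDevelopment D)
    (S T : Set 𝒟.carrier) (𝓣 : Spacetime.{u} (n + 1)) {E' : Set 𝒟.carrier}
    {χ : 𝒟.carrier → 𝓣.carrier}
    (hEE' : 𝒟.metric.causalFuture 𝒟.timeOrientation S \ 𝒟.metric.causalFuture 𝒟.timeOrientation T ⊆ E')
    (hE'o : IsOpen E') (hχs : ContMDiffOn (𝓡 (n + 1)) (𝓡 (n + 1)) ∞ χ E')
    (hχi : ∀ p ∈ E', pullbackBilin (I := 𝓡 (n + 1)) (I' := 𝓡 (n + 1)) χ 𝓣.metric.val p =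
      𝒟.metric.val p)
    (hχτ : ∀ p ∈ E', 𝓣.timeOrientation.IsFutureDirected
      (mfderiv (𝓡 (n + 1)) (𝓡 (n + 1)) χ p (𝒟.timeOrientation.vectorField p)))
    {p q : 𝒟.carrier}
    (hp : p ∈ 𝒟.metric.causalFuture 𝒟.timeOrientation S \ 𝒟.metric.causalFuture 𝒟.timeOrientation T)
    (hq : q ∈ 𝒟.metric.causalFuture 𝒟.timeOrientation S \ 𝒟.metric.causalFuture 𝒟.timeOrientation T) :
    𝒟.toSpacetime.lorentzDist p q ≤ 𝓣.lorentzDist (χ p) (χ q) := by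
  refine LorentzianMetric.lorentzDist_le_iff.2 fun γ a b hab hγ hγa hγb ↦ ?_
  have ha : γ a ∈ 𝒟.metric.causalFuture 𝒟.timeOrientation S \
      𝒟.metric.causalFuture 𝒟.timeOrientation T := by rw [hγa]; exact hp
  have hb : γ b ∈ 𝒟.metric.causalFuture 𝒟.timeOrientation S \
      𝒟.metric.causalFuture 𝒟.timeOrientation T := by rw [hγb]; exact hq
  have hχγ := isFutureCausalCurveOn_comp_of_exactRegion 𝒟 S T 𝓣 hEE' hE'o hχs hχi hχτ hγ ha hb
  have hlen := arcLength_comp_of_exactRegion 𝒟 S T 𝓣 hEE' hE'o hχs hχi hγ ha hb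
  calc 𝒟.metric.toPseudoRiemannianMetric.arcLength γ a b
      = 𝓣.metric.toPseudoRiemannianMetric.arcLength (χ ∘ γ) a b := hlen.symm
    _ ≤ 𝓣.lorentzDist (χ p) (χ q) :=
        LorentzianMetric.arcLength_le_lorentzDist hab hχγ (by simp [hγa]) (by simp [hγb])

/-- **Clause (B3) of stub B, reduced to the target**: under the hypotheses of
`lorentzDist_le_lorentzDist_comp_of_exactRegion`, a uniform bound `d_𝓣(χ p, y) ≤ C` for all `y`
(for Kerr: `χ p` in region II, whose future has finite timelike diameter) gives `d_𝒟(p, q) ≤ C`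
for every `q` in the exact region. O'Neill 1983, Ch. 14, Def. 14.15.
[cite: ONeillSemiRiemannian1983, Ch. 14, Def. 14.15 (p. 409)] -/
theorem lorentzDist_le_of_exactRegion (𝒟 : CauchyDevelopment D) (S T : Set 𝒟.carrier)
    (𝓣 : Spacetime.{u} (n + 1)) {E' : Set 𝒟.carrier} {χ : 𝒟.carrier → 𝓣.carrier}
    (hEE' : 𝒟.metric.causalFuture 𝒟.timeOrientation S \ 𝒟.metric.causalFuture 𝒟.timeOrientation T ⊆ E')
    (hE'o : IsOpen E') (hχs : ContMDiffOn (𝓡 (n + 1)) (𝓡 (n + 1)) ∞ χ E')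
    (hχi : ∀ p ∈ E', pullbackBilin (I := 𝓡 (n + 1)) (I' := 𝓡 (n + 1)) χ 𝓣.metric.val p =
      𝒟.metric.val p)
    (hχτ : ∀ p ∈ E', 𝓣.timeOrientation.IsFutureDirected
      (mfderiv (𝓡 (n + 1)) (𝓡 (n + 1)) χ p (𝒟.timeOrientation.vectorField p)))
    {C : ℝ≥0∞} {p : 𝒟.carrier}
    (hp : p ∈ 𝒟.metric.causalFuture 𝒟.timeOrientation S \ 𝒟.metric.causalFuture 𝒟.timeOrientation T)
    (hC : ∀ y, 𝓣.lorentzDist (χ p) y ≤ C) {q : 𝒟.carrier}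
    (hq : q ∈ 𝒟.metric.causalFuture 𝒟.timeOrientation S \ 𝒟.metric.causalFuture 𝒟.timeOrientation T) :
    𝒟.toSpacetime.lorentzDist p q ≤ C :=
  (lorentzDist_le_lorentzDist_comp_of_exactRegion 𝒟 S T 𝓣 hEE' hE'o hχs hχi hχτ hp hq).trans (hC _)

end Summit.FinalStateConjecture.FinalStateConjecture.Theorems.PhotonSphereChannels.TameCensorshipCrush

end
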